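import Literature.Computation.Certificates.PackedGramCertificateRows
import Literature.Computation.Certificates.Data

/-!
# Packed Gram certificates, rows layout, over LIST data: in-kernel packing and the round trip

Compute-infrastructure companion of `PackedGramCertificateRows.lean` (certnum L4 lane «packed /
Kronecker PSD certificates», ladder GRIDFUSION RULING 19 (3)). The packed rows checker
`PSD.Packed.checkRows n w den v x O Arows d Crows` reads the integer matrix from `n` NATURAL row
literals (`w` bits per entry, offset `2^(w-1)`) and the factor from compact column literals. Emitters
of the ℤ-list lanes (`PosSemidefIntList.lean`, gridfusion `emit_lean.py`) already ship the SAME data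
as plain lists — `rows : List (List ℤ)` (the integer Gram `A`), `d : List ℕ`, `cols : List (List ℤ)`
(the columns of the integer factor `B`). This file lets a consumer run the packed check on THOSE
lists without any new literal:

* `PSD.Packed.packRow w row`, `PSD.Packed.packCol v O col` — the positional packings, written with
  ALL arithmetic in `ℕ` (`offsetDigit` by cases on the sign; see the cost note below), so the kernel
  packs a 119 × 119 block of 263-bit entries in well under a second;
* `PSD.Packed.packable n w rows` — the decidable side condition (`0 < w`, `n ≤ |rows|`, every row has
  `≥ n` entries, every entry `|a| < 2^(w-1)`), pure `ℕ` comparisons;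
* **`PSD.Packed.rowEntry_packRow`** / **`intMatrixRows_map_packRow`** — the ROUND TRIP: under
  `packable`, the matrix the checker reads from the packed rows IS `matrixOfRows n n rows`;
* **`PSD.Packed.isGramCertZ_matrixOfRows_of_checkRows`** — hence a passing
  `checkRows … (rows.map (packRow w)) d Crows` is an integer rounded Gram certificate
  `PSD.IsGramCertZ (matrixOfRows n n rows) (weights d) (factorRows v O d Crows n)` — exactly the
  hypothesis shape of `GramSOS.quadNonneg_of_gramCertZ` / `GramL.quadNonneg_of_gramCertZ` that the
  ℤ-list lane produces with `PSD.IsGramCertZ.of_listCheck'`, so the two lanes are interchangeable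
  per block (the factor argument is irrelevant to every consumer).

Kernel cost note (measured 2026-08-27 on the real deg-4 WSCC9 V̇ block, s = 119, 263-bit entries,
gridfusion file of record bc1c5ab5…; certnum-sdp-3 `kernel/l4real/RESULTS.md`): the whole file
«pack in the kernel + `checkRows`» elaborates in 85 s wall with ONE `decide +kernel`; a first version
that formed the offset digit as `Int.toNat (a + 2^(w-1))` took 182 s — `Int` arithmetic producing or
consuming large negative values with many trailing zero bits (every dyadic-scaled Gram entry) costs
≈ 10 ms per operation in kernel reduction, whereas the two-case `ℕ` formula below is free. This is an
efficiency remark only; soundness does not depend on it.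

WHAT THIS FILE DOES NOT CERTIFY: anything about a matrix OTHER than `matrixOfRows n n rows` (a
consumer whose Gram block is a rational `Q` still needs its own scale identity `A = c • Q`, e.g. the
ℤ-list lane's `zscale`); the packing functions are not injective outside `packable` (rows that are too
short or entries out of range decode to DIFFERENT integers — which can only make `checkRows` certify
the wrong matrix if `packable` is not checked; the theorems below require it).

References: positional (Kronecker) packing of integer vectors into one natural [cite: Harvey2009, §3.1]
(D. Harvey, *Faster polynomial multiplication via multipoint Kronecker substitution*, J. Symb. Comp.
44 (2009); arXiv:0712.4046, §3.1 read); diagonal dominance of the rounded-Gram residual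
[cite: BlekhermanParriloThomas2012, App. A.1.2].
-/

namespace Literature.Computation.Certificates

namespace PSD

namespace Packed

/-! ### Packing list data in the kernel (ℕ arithmetic only) -/

/-- The offset digit `a + off` of an integer, computed by cases on the sign with `ℕ` arithmetic only
(`|a| ≤ off` intended; then it IS `a + off`, see `offsetDigit_cast`). [folklore] -/
def offsetDigit (off : ℕ) (a : ℤ) : ℕ :=
  match a with
  | .ofNat m => m + off
  | .negSucc m => off - (m + 1)

/-- Within range, the offset digit is `a + off`. [folklore] -/
private theorem offsetDigit_cast {off : ℕ} {a : ℤ} (h : a.natAbs < off) :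
    ((offsetDigit off a : ℕ) : ℤ) = a + off := by
  cases a with
  | ofNat m => simp [offsetDigit]
  | negSucc m =>
      simp only [Int.natAbs_negSucc] at h
      have hle : m + 1 ≤ off := h.le
      simp only [offsetDigit, Int.negSucc_eq]
      push_cast [hle]
      ring

/-- Within range, the offset digit is `< 2·off`. [folklore] -/
private theorem offsetDigit_lt {off : ℕ} {a : ℤ} (h : a.natAbs < off) : offsetDigit off a < 2 * off := by
  cases a with
  | ofNat m =>
      simp only [offsetDigit]
      simp only [Int.ofNat_eq_natCast, Int.natAbs_natCast] at h
      omega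
  | negSucc m =>
      simp only [Int.natAbs_negSucc] at h
      simp only [offsetDigit]
      omega

/-- Pack one integer row `[a₀, a₁, …]` into ONE natural `Σ_j (a_j + 2^(w-1))·2^(w·j)` — the row
literal format of `checkRows` (`rowEntry w · j` reads entry `j` back). All arithmetic in `ℕ`.
[cite: Harvey2009, §3.1] -/
def packRow (w : ℕ) (row : List ℤ) : ℕ :=
  row.foldr (fun a acc => acc * 2 ^ w + offsetDigit (2 ^ (w - 1)) a) 0

/-- Pack one factor COLUMN `[B_0i, B_1i, …]` into ONE natural `Σ_k (B_ki + O)·(2^v)^k` — the compact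
factor format of `checkRows` (digits base `2^v`, offset `O`). All arithmetic in `ℕ`.
[cite: Harvey2009, §3.1] -/
def packCol (v O : ℕ) (col : List ℤ) : ℕ :=
  col.foldr (fun b acc => acc * 2 ^ v + offsetDigit O b) 0

/-- The decidable side condition of the round trip: `0 < w`, at least `n` rows, every row has at
least `n` entries and every entry satisfies `|a| < 2^(w-1)`. Pure `ℕ` comparisons (kernel-cheap).
[folklore] -/
def packable (n w : ℕ) (rows : List (List ℤ)) : Bool :=
  decide (0 < w) && decide (n ≤ rows.length) &&
    rows.all fun r => decide (n ≤ r.length) && r.all fun a => decide (a.natAbs < 2 ^ (w - 1))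

/-- Unfolding `packRow` on a cons. [folklore] -/
private theorem packRow_cons (w : ℕ) (a : ℤ) (r : List ℤ) :
    packRow w (a :: r) = packRow w r * 2 ^ w + offsetDigit (2 ^ (w - 1)) a := rfl

/-! ### The round trip -/

/-- **Round trip, one row**: reading entry `j` of the packed row gives the list entry back
(in range). [cite: Harvey2009, §3.1] -/
theorem rowEntry_packRow {w : ℕ} (hw : 0 < w) :
    ∀ {row : List ℤ}, (∀ a ∈ row, a.natAbs < 2 ^ (w - 1)) → ∀ {j : ℕ}, j < row.length →
      rowEntry w (packRow w row) j = row.getD j 0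
  | [], _, j, hj => by simp at hj
  | a :: r, hb, j, hj => by
      have ha : a.natAbs < 2 ^ (w - 1) := hb a (by simp)
      have hoff : 2 * 2 ^ (w - 1) = 2 ^ w := by
        rw [← Nat.pow_succ']; congr 1; omega
      have hdlt : offsetDigit (2 ^ (w - 1)) a < 2 ^ w := hoff ▸ offsetDigit_lt ha
      have hpos : 0 < 2 ^ w := Nat.two_pow_pos w
      cases j with
      | zero =>
          simp only [rowEntry, packRow_cons, Nat.mul_zero, Nat.shiftRight_zero, List.getD_cons_zero]
          rw [Nat.mul_add_mod_of_lt hdlt, offsetDigit_cast ha]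
          ring
      | succ k =>
          have hk : k < r.length := by simpa using hj
          have ih := rowEntry_packRow hw (row := r) (fun b hb' => hb b (by simp [hb'])) hk
          simp only [rowEntry, List.getD_cons_succ] at ih ⊢
          rw [← ih]
          congr 3
          simp only [Nat.shiftRight_eq_div_pow, packRow_cons]
          rw [Nat.mul_succ, Nat.pow_add, Nat.mul_comm (2 ^ (w * k)) (2 ^ w), ← Nat.div_div_eq_div_mul,
            Nat.mul_comm (packRow w r) (2 ^ w), Nat.mul_add_div hpos, Nat.div_eq_of_lt hdlt, Nat.add_zero]

/-- Unpacking the Boolean side condition. [folklore] -/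
private theorem packable_spec {n w : ℕ} {rows : List (List ℤ)} (hp : packable n w rows = true) :
    0 < w ∧ n ≤ rows.length ∧ ∀ r ∈ rows, n ≤ r.length ∧ ∀ a ∈ r, a.natAbs < 2 ^ (w - 1) := by
  simp only [packable, Bool.and_eq_true, decide_eq_true_eq, List.all_eq_true] at hp
  obtain ⟨⟨hw, hn⟩, hrows⟩ := hp
  exact ⟨hw, hn, fun r hr => ⟨(hrows r hr).1, fun a ha => (hrows r hr).2 a ha⟩⟩

/-- **Round trip, whole matrix**: under `packable`, the integer matrix the packed checker reads
from the packed rows is the list-of-rows matrix itself. [cite: Harvey2009, §3.1] -/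
theorem intMatrixRows_map_packRow {n w : ℕ} {rows : List (List ℤ)} (hp : packable n w rows = true) :
    intMatrixRows n w (rows.map (packRow w)) = matrixOfRows n n rows := by
  obtain ⟨hw, hn, hrows⟩ := packable_spec hp
  ext i j
  have hi : i.val < rows.length := lt_of_lt_of_le i.isLt hn
  have hmem : rows[i.val] ∈ rows := List.getElem_mem hi
  obtain ⟨hlen, hb⟩ := hrows _ hmem
  simp only [intMatrixRows, matrixOfRows, List.getD_eq_getElem?_getD, List.getElem?_map,
    List.getElem?_eq_getElem hi, Option.map_some, Option.getD_some]
  rw [rowEntry_packRow hw hb (lt_of_lt_of_le j.isLt hlen), List.getD_eq_getElem?_getD]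

/-- **Soundness on list data**: a passing packed rows check of the IN-KERNEL packing of `rows`,
together with `packable`, is an integer rounded Gram certificate for `matrixOfRows n n rows` — the
statement shape produced by the ℤ-list lane (`PSD.IsGramCertZ.of_listCheck'`), consumed unchanged
by `GramSOS.quadNonneg_of_gramCertZ` (whose factor argument is arbitrary).
[cite: BlekhermanParriloThomas2012, App. A.1.2] -/
theorem isGramCertZ_matrixOfRows_of_checkRows {n w den v x O : ℕ} {rows : List (List ℤ)}
    {d Crows : List ℕ} (h : checkRows n w den v x O (rows.map (packRow w)) d Crows = true)
    (hp : packable n w rows = true) :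
    IsGramCertZ (matrixOfRows n n rows) (weights d) (factorRows v O d Crows n) := by
  rw [← intMatrixRows_map_packRow hp]
  exact isGramCertZ_of_checkRows h

/-- **Positive semidefiniteness on list data** (any linearly ordered field with trivial star, e.g.
`ℝ`): the rational matrix `(matrixOfRows n n rows) / den` … stated for the integer matrix cast.
[cite: BlekhermanParriloThomas2012, App. A.1.2] -/
theorem posSemidef_matrixOfRows_of_checkRows {R' : Type*} [Field R'] [LinearOrder R']
    [IsStrictOrderedRing R'] [StarRing R'] [TrivialStar R'] {n w den v x O : ℕ}
    {rows : List (List ℤ)} {d Crows : List ℕ}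
    (h : checkRows n w den v x O (rows.map (packRow w)) d Crows = true)
    (hp : packable n w rows = true) :
    ((matrixOfRows n n rows).map (Int.cast : ℤ → R')).PosSemidef :=
  (isGramCertZ_matrixOfRows_of_checkRows h hp).posSemidef

/-! ### Kernel-checked example (the `3 × 3` path-graph matrix of `PackedGramCertificateRows.lean`,
now given as LISTS and packed in the kernel) -/

/-- Test rows `[[2,-1,0],[-1,2,-1],[0,-1,2]]`. [folklore] -/
def exRows : List (List ℤ) := [[2, -1, 0], [-1, 2, -1], [0, -1, 2]]

/-- Test factor columns of `B = [[1,-1,0],[0,1,-1],[0,0,1]]` (column `i` lists `B_ki` over `k`).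
[folklore] -/
def exCols : List (List ℤ) := [[1, 0, 0], [-1, 1, 0], [0, -1, 1]]

/-- Test: the side condition holds (`w = 4`). -/
example : packable 3 4 exRows = true := by decide +kernel

/-- Test: the packed rows check passes on the in-kernel packing (`w = 4`, unit weights, `v = 3`,
`x = 8`, `O = 2`). -/
example : checkRows 3 4 1 3 8 2 (exRows.map (packRow 4)) [1, 1, 1] (exCols.map (packCol 3 2)) = true := by
  decide +kernel

/-- Test: hence `matrixOfRows 3 3 exRows` is positive semidefinite over `ℝ`. -/
example : ((matrixOfRows 3 3 exRows).map (Int.cast : ℤ → ℝ)).PosSemidef :=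
  posSemidef_matrixOfRows_of_checkRows (R' := ℝ) (w := 4) (den := 1) (v := 3) (x := 8) (O := 2)
    (d := [1, 1, 1]) (Crows := exCols.map (packCol 3 2)) (by decide +kernel) (by decide +kernel)

/-! ### Split rows check on list data (APPEND 2026-08-27, certnum-sdp-3 g5)

For blocks whose single `checkRows` decide exceeds a per-file kernel budget (law ≈ n^3.3 at fixed bit
sizes; e.g. n = 189 with 60-bit entries), `PackedGramCertificateRows.lean` provides the SPLIT check
`checkRowsHead` + `checkRowsRange` per row range (`RangesOK`, one `decide +kernel` per file) assembled
by `isGramCertZ_of_checkRowsRanges`. The round trip `intMatrixRows_map_packRow` transports that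
conclusion to `matrixOfRows n n rows` exactly as for the one-piece check. -/

/-- **Soundness of the SPLIT rows check on list data**: the head check and range facts covering all
`n` rows of the IN-KERNEL packing `rows.map (packRow w)`, together with `packable`, give the integer
rounded Gram certificate for `matrixOfRows n n rows` — the same conclusion as
`isGramCertZ_matrixOfRows_of_checkRows`. [cite: BlekhermanParriloThomas2012, App. A.1.2] -/
theorem isGramCertZ_matrixOfRows_of_checkRowsRanges {n w den v x O : ℕ} {rows : List (List ℤ)}
    {d Crows cnts : List ℕ}
    (hhead : checkRowsHead n w den v x O (rows.map (packRow w)) d Crows = true)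
    (hranges : RangesOK w v x O (rows.map (packRow w)) d Crows 0 cnts) (hcov : n ≤ cnts.sum)
    (hp : packable n w rows = true) :
    IsGramCertZ (matrixOfRows n n rows) (weights d) (factorRows v O d Crows n) := by
  rw [← intMatrixRows_map_packRow hp]
  exact isGramCertZ_of_checkRowsRanges hhead hranges hcov

/-- **Positive semidefiniteness on list data from the SPLIT check** (any linearly ordered field with
trivial star). [cite: BlekhermanParriloThomas2012, App. A.1.2] -/
theorem posSemidef_matrixOfRows_of_checkRowsRanges {R' : Type*} [Field R'] [LinearOrder R']
    [IsStrictOrderedRing R'] [StarRing R'] [TrivialStar R'] {n w den v x O : ℕ}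
    {rows : List (List ℤ)} {d Crows cnts : List ℕ}
    (hhead : checkRowsHead n w den v x O (rows.map (packRow w)) d Crows = true)
    (hranges : RangesOK w v x O (rows.map (packRow w)) d Crows 0 cnts) (hcov : n ≤ cnts.sum)
    (hp : packable n w rows = true) :
    ((matrixOfRows n n rows).map (Int.cast : ℤ → R')).PosSemidef :=
  (isGramCertZ_matrixOfRows_of_checkRowsRanges hhead hranges hcov hp).posSemidef

/-- Test: the split check on the `3 × 3` list example, ranges `[0,2) ∪ [2,3)`, packed in the kernel
(`w = 4`, unit weights, `v = 3`, `x = 8`, `O = 2`). -/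
example : ((matrixOfRows 3 3 exRows).map (Int.cast : ℤ → ℝ)).PosSemidef :=
  posSemidef_matrixOfRows_of_checkRowsRanges (R' := ℝ) (w := 4) (den := 1) (v := 3) (x := 8) (O := 2)
    (d := [1, 1, 1]) (Crows := exCols.map (packCol 3 2)) (cnts := [2, 1]) (by decide +kernel)
    ⟨by decide +kernel, by decide +kernel, trivial⟩ (by norm_num) (by decide +kernel)

end Packed

end PSD

end Literature.Computation.Certificates
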